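import Summits.CriticalPhenomena.PercolationContinuityZ3.Theorems.Transplant.HexShadowVRoutingR
import Summits.CriticalPhenomena.PercolationContinuityZ3.Theorems.Transplant.Slab111SK4FinalK3
import HarnessLib

/-!
# The `(111)`-film of thickness `3` dies at its own critical point — independently of p205010 (light-import statement)

builds on p205010 (kernel theorem, internal audit signed; external expert review pending) — NOT used: p205010's declarations are absent from the DECLARATION-LEVEL cone of
`slab111OwnCriticalContinuity_k3` (transitive used-constants closure: 3 129 project constants, 0 of the `…Theorems.CSH.*` / `PercNearOneGluing*` family; the
import graph is NOT separated — shared scope/statement modules import p205010's module).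
Lane `prim-bschramm`, seat `prim-bschramm-p2` (gen 39; class C1b; memo `HOME/bschramm/P2-LATTICES.md` §137); helper file (`--supports stmt-CriticalPhenomena-4575 --as helper`).
The radius-`4` kernel certificate **`Slab111.shapedLinkage_four_k3`** («Slab111SK4FinalK3») and the radius-generic routing «HexShadowVRoutingR»
(`slab111OwnCriticalContinuity_of_shapedLinkageR`) give **`slab111OwnCriticalContinuity_k3`**.  (The row statements for `k ≥ 3` / `k ≠ 2` live in «Slab111K3Final».)
[cite: DuminilCopinSidoraviciusTassion2016, Thm. 1, §2.3 (proof of Fact 2, "fix R")] [cite: BenjaminiSchramm1996, Conj. 4 / Question 3]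
-/

noncomputable section

namespace Summit.CriticalPhenomena.PercolationContinuityZ3.Theorems.Transplant

open Literature.Probability.Percolation Literature.Probability.LatticeModels SimpleGraph

/-- **THE `(111)`-FILM `{0 ≤ x₀+x₁+x₂ ≤ 3}` OF `ℤ³` DIES AT ITS OWN CRITICAL POINT — independently of p205010** (surgery radius `4`).
[cite: DuminilCopinSidoraviciusTassion2016, Thm. 1, §2.3] [cite: BenjaminiSchramm1996, Conj. 4 / Question 3] -/
theorem slab111OwnCriticalContinuity_k3 : Slab111OwnCriticalContinuity 3 :=
  slab111OwnCriticalContinuity_of_shapedLinkageR (by norm_num) (by norm_num) Slab111.shapedLinkage_four_k3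

end Summit.CriticalPhenomena.PercolationContinuityZ3.Theorems.Transplant

end
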